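import Literature.NumberTheory.ModularForms.UniformBounds
import Literature.NumberTheory.ModularForms.KernelResidues
import Literature.NumberTheory.ModularForms.LogLambdaThirdOrder
import Literature.NumberTheory.ModularForms.QAsymptotics3
import HarnessLib

/-!
# Tools for CKMRV Lemma 4.9: product truncations, `2`-periodicity, uniform coefficient bounds

Cohn–Kumar–Miller–Radchenko–Viazovska, arXiv:1902.05438, Lemma 4.9 (proof): "the expressions …
when multiplied by `Δ(τ)Δ(z)(j(τ)−j(z))`, are finite sums `Σ_{j,k} φ_{jk}(τ,z)τ^j z^k`, where
`φ_{jk}` is holomorphic on `ℍ×ℍ` with `φ_{jk}(τ+2,z) = φ_{jk}(τ,z) = φ_{jk}(τ,z+2)`. The claims then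
follow from the form of the double power series expansion of `φ_{jk}` in `e^{πiτ}` and `e^{πiz}`,
which can be shown by direct calculation to vanish to the asserted order."

This file supplies the variable-separated form of that argument; everything is proved:
* `sum_mul_eq_sum_rem_mul_rem`: if `fᵢ = Pᵢ + rᵢ`, `gᵢ = Qᵢ + tᵢ` with `ΣPᵢgᵢ = ΣfᵢQᵢ = ΣPᵢQᵢ = 0`
  then `Σfᵢgᵢ = Σrᵢtᵢ` (so `|Σfᵢgᵢ| ≤ Σ|rᵢ||tᵢ|`);
* `2`-periodicity of the basic functions: `U, V, W, E₂, Δ, E₄, E₆, q^{1/2}, 𝓛_S` and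
  `M = 𝓛 − πiτ` (`logLambda (2 +ᵥ τ) = logLambda τ + 2πi`);
* uniform coefficient bounds on half-planes `Im τ ≥ δ` (via `UniformBounds`) for the truncations
  proved at `i∞` in `QAsymptotics*`, `ThetaFourthOrder`, `LogLambdaThirdOrder`:
  `U − (1+8b+24b²+32b³)`, `W − (1−8b+24b²−32b³)` (order `b⁴`), `V − (16b+64b³)` (`b⁵`),
  `E₄ − 1 − 240q − 2160q²`, `E₆ − 1 + 504q + 16632q²`, `Δ − q + 24q²` (`b⁶`), `E₂ − 1 + 24q + 72q²`
  (`b⁶`), `𝓛_S + 16b` (`b³`), `M − log 16 + 8b − 12b²` (`b³`) (`b = e^{πiτ}`, `q = b²`).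

## References

* H. Cohn, A. Kumar, S. D. Miller, D. Radchenko, M. Viazovska, Ann. of Math. 196 (2022),
  arXiv:1902.05438, Lemma 4.9. [CohnEtAl2019]
-/

noncomputable section

open Complex hiding I
open Filter Topology Asymptotics ModularForm SlashInvariantForm EisensteinSeries
open UpperHalfPlane hiding I
open Complex (I)
open scoped Real MatrixGroups ModularForm Manifold

namespace Literature.NumberTheory.ModularForms

/-! ## The product-truncation identity -/

/-- **Product truncation.** If `fᵢ = Pᵢ + rᵢ` and `gᵢ = Qᵢ + tᵢ` with `Σ Pᵢgᵢ = 0`, `Σ fᵢQᵢ = 0`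
and `Σ PᵢQᵢ = 0`, then `Σ fᵢgᵢ = Σ rᵢtᵢ`. [folklore] -/
theorem sum_mul_eq_sum_rem_mul_rem {ι : Type*} (s : Finset ι) (f P r g Q t : ι → ℂ)
    (hf : ∀ i ∈ s, f i = P i + r i) (hg : ∀ i ∈ s, g i = Q i + t i)
    (h1 : ∑ i ∈ s, P i * g i = 0) (h2 : ∑ i ∈ s, f i * Q i = 0) (h3 : ∑ i ∈ s, P i * Q i = 0) :
    ∑ i ∈ s, f i * g i = ∑ i ∈ s, r i * t i := by
  have e1 : ∑ i ∈ s, f i * g i = ∑ i ∈ s, (P i * g i + f i * Q i - P i * Q i + r i * t i) := by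
    refine Finset.sum_congr rfl fun i hi => ?_
    rw [hf i hi, hg i hi]; ring
  rw [e1, Finset.sum_add_distrib, Finset.sum_sub_distrib, Finset.sum_add_distrib, h1, h2, h3]
  ring

/-- The resulting bound `‖Σ fᵢgᵢ‖ ≤ Σ ‖rᵢ‖‖tᵢ‖`. [folklore] -/
theorem norm_sum_mul_le_of_truncations {ι : Type*} (s : Finset ι) (f P r g Q t : ι → ℂ)
    (hf : ∀ i ∈ s, f i = P i + r i) (hg : ∀ i ∈ s, g i = Q i + t i)
    (h1 : ∑ i ∈ s, P i * g i = 0) (h2 : ∑ i ∈ s, f i * Q i = 0) (h3 : ∑ i ∈ s, P i * Q i = 0) :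
    ‖∑ i ∈ s, f i * g i‖ ≤ ∑ i ∈ s, ‖r i‖ * ‖t i‖ := by
  rw [sum_mul_eq_sum_rem_mul_rem s f P r g Q t hf hg h1 h2 h3]
  refine (norm_sum_le _ _).trans (Finset.sum_le_sum fun i _ => ?_)
  rw [norm_mul]

/-! ## `2`-periodicity of the basic functions -/

/-- `two_vadd_eq` (auxiliary). [folklore] -/
theorem two_vadd_eq (τ : ℍ) : (2 : ℝ) +ᵥ τ = (1 : ℝ) +ᵥ ((1 : ℝ) +ᵥ τ) := by
  rw [vadd_vadd]; norm_num

/-- `U, V, W` are `2`-periodic. [cite: CohnEtAl2019, §2.1.2] -/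
theorem thetaUVW_vadd_two (τ : ℍ) :
    thetaU ((2 : ℝ) +ᵥ τ) = thetaU τ ∧ thetaV ((2 : ℝ) +ᵥ τ) = thetaV τ ∧ thetaW ((2 : ℝ) +ᵥ τ) = thetaW τ := by
  refine ⟨?_, ?_, ?_⟩ <;> rw [two_vadd_eq]
  · rw [thetaU_vadd_one, thetaW_vadd_one]
  · rw [thetaV_vadd_one, thetaV_vadd_one, neg_neg]
  · rw [thetaW_vadd_one, thetaU_vadd_one]

/-- `E₂` is `2`-periodic. [folklore] -/
theorem E2_vadd_two (τ : ℍ) : E2 ((2 : ℝ) +ᵥ τ) = E2 τ := by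
  rw [two_vadd_eq, E2_vadd_one, E2_vadd_one]

/-- A level-one modular form is `2`-periodic. [folklore] -/
theorem levelOne_vadd_two {k : ℤ} (f : ModularForm 𝒮ℒ k) (τ : ℍ) : f ((2 : ℝ) +ᵥ τ) = f τ := by
  have hT : (⇑f : ℍ → ℂ) ∣[k] ModularGroup.T = ⇑f := f.slash_action_eq' _ ⟨ModularGroup.T, rfl⟩
  have h1 : ∀ σ : ℍ, f ((1 : ℝ) +ᵥ σ) = f σ := fun σ => by
    have := slash_T_apply (⇑f) k σ
    rw [hT] at this
    exact this.symm
  rw [two_vadd_eq, h1, h1]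

/-- `Δ` is `2`-periodic. [folklore] -/
theorem discriminant_vadd_two (τ : ℍ) : ModularForm.discriminant ((2 : ℝ) +ᵥ τ) = ModularForm.discriminant τ :=
  levelOne_vadd_two (CuspForm.discriminant : ModularForm 𝒮ℒ 12) τ

/-- `q^{1/2}` is `2`-periodic and `q` is `1`-periodic. [folklore] -/
theorem qhalf_vadd_two (τ : ℍ) : qhalf ((2 : ℝ) +ᵥ τ) = qhalf τ := by
  rw [two_vadd_eq, qhalf_vadd_one, qhalf_vadd_one, neg_neg]

/-- `qfun_vadd_two` (auxiliary). [folklore] -/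
theorem qfun_vadd_two (τ : ℍ) : qfun ((2 : ℝ) +ᵥ τ) = qfun τ := by
  rw [← qhalf_sq, ← qhalf_sq, qhalf_vadd_two]

/-- `𝓛_S` is `2`-periodic; `𝓛(τ + 2) = 𝓛(τ) + 2πi`, so `M = 𝓛 − πiτ` is `2`-periodic.
[cite: CohnEtAl2019, §2.1.2 (2.11)] -/
theorem logLambdaS_vadd_two (τ : ℍ) : logLambdaS ((2 : ℝ) +ᵥ τ) = logLambdaS τ := by
  rw [two_vadd_eq, logLambdaS_vadd_one, logLambdaS_vadd_one, neg_neg]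

/-- `logLambda_vadd_two` (auxiliary). [folklore] -/
theorem logLambda_vadd_two (τ : ℍ) : logLambda ((2 : ℝ) +ᵥ τ) = logLambda τ + 2 * π * I := by
  rw [two_vadd_eq, logLambda_vadd_one, logLambda_vadd_one, logLambdaS_vadd_one]; ring

/-- `M := 𝓛 − πiτ` (the `2`-periodic part of `𝓛`). [cite: CohnEtAl2019, §2.1.2 (2.10)] -/
def logLambdaPer (τ : ℍ) : ℂ := logLambda τ - π * I * τ

/-- `logLambdaPer_vadd_two` (auxiliary). [folklore] -/
theorem logLambdaPer_vadd_two (τ : ℍ) : logLambdaPer ((2 : ℝ) +ᵥ τ) = logLambdaPer τ := by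
  simp only [logLambdaPer, logLambda_vadd_two, UpperHalfPlane.coe_vadd]
  push_cast; ring

/-- `logLambda_eq_logLambdaPer` (auxiliary). [folklore] -/
theorem logLambda_eq_logLambdaPer (τ : ℍ) : logLambda τ = π * I * τ + logLambdaPer τ := by
  simp [logLambdaPer]

/-! ## Continuity -/

/-- `continuous_thetaU` (auxiliary). [folklore] -/
@[fun_prop] theorem continuous_thetaU : Continuous thetaU := mdifferentiable_thetaU.continuous
/-- `continuous_thetaV` (auxiliary). [folklore] -/
@[fun_prop] theorem continuous_thetaV : Continuous thetaV := mdifferentiable_thetaV.continuous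
/-- `continuous_thetaW` (auxiliary). [folklore] -/
@[fun_prop] theorem continuous_thetaW : Continuous thetaW := mdifferentiable_thetaW.continuous
/-- `continuous_qhalf` (auxiliary). [folklore] -/
@[fun_prop] theorem continuous_qhalf : Continuous qhalf := by unfold qhalf; fun_prop
/-- `continuous_qfun` (auxiliary). [folklore] -/
@[fun_prop] theorem continuous_qfun : Continuous qfun := by unfold qfun; fun_prop
attribute [fun_prop] continuous_logLambdaS
/-- `continuous_logLambdaPer` (auxiliary). [folklore] -/
@[fun_prop] theorem continuous_logLambdaPer : Continuous logLambdaPer := by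
  unfold logLambdaPer; exact continuous_logLambda.sub (by fun_prop)
attribute [fun_prop] continuous_E2'
/-- `continuous_discriminant'` (auxiliary). [folklore] -/
@[fun_prop] theorem continuous_discriminant' : Continuous (ModularForm.discriminant : ℍ → ℂ) :=
  CuspForm.discriminant.holo'.continuous

/-! ## Uniform coefficient bounds on half-planes -/

/-- Generic transfer: a continuous `2`-periodic `G` with `G = O(e^{−nπy})` at `i∞` is bounded by
`C_δ e^{−nπ Im τ}` on `Im τ ≥ δ`. [folklore] -/
theorem uniform_of_two_periodic {G : ℍ → ℂ} (hc : Continuous G) (hper : ∀ τ : ℍ, G ((2 : ℝ) +ᵥ τ) = G τ)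
    (n : ℕ) (hO : G =O[atImInfty] fun τ => expDecayHalf τ ^ n) {δ : ℝ} (hδ : 0 < δ) :
    ∃ C : ℝ, ∀ τ : ℍ, δ ≤ τ.im → ‖G τ‖ ≤ C * expDecayHalf τ ^ n :=
  uniform_bound_of_periodic_isBigO_exp hc two_pos hper n hO hδ

/-- **Uniform fourth-order bounds for `U`, `W` and fifth-order for `V` on `Im τ ≥ δ`.**
[cite: CohnEtAl2019, §2.1.2 (2.8)] -/
theorem thetaUVW_uniform {δ : ℝ} (hδ : 0 < δ) :
    (∃ C : ℝ, ∀ τ : ℍ, δ ≤ τ.im → ‖thetaU τ - 1 - 8 * qhalf τ - 24 * qhalf τ ^ 2 - 32 * qhalf τ ^ 3‖ ≤ C * expDecayHalf τ ^ 4) ∧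
    (∃ C : ℝ, ∀ τ : ℍ, δ ≤ τ.im → ‖thetaW τ - 1 + 8 * qhalf τ - 24 * qhalf τ ^ 2 + 32 * qhalf τ ^ 3‖ ≤ C * expDecayHalf τ ^ 4) ∧
    (∃ C : ℝ, ∀ τ : ℍ, δ ≤ τ.im → ‖thetaV τ - 16 * qhalf τ - 64 * qhalf τ ^ 3‖ ≤ C * expDecayHalf τ ^ 5) := by
  have hU2 : ∀ τ : ℍ, thetaU ((2 : ℝ) +ᵥ τ) = thetaU τ := fun τ => (thetaUVW_vadd_two τ).1
  have hV2 : ∀ τ : ℍ, thetaV ((2 : ℝ) +ᵥ τ) = thetaV τ := fun τ => (thetaUVW_vadd_two τ).2.1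
  have hW2 : ∀ τ : ℍ, thetaW ((2 : ℝ) +ᵥ τ) = thetaW τ := fun τ => (thetaUVW_vadd_two τ).2.2
  refine ⟨?_, ?_, ?_⟩
  · refine uniform_of_two_periodic (G := fun τ => thetaU τ - 1 - 8 * qhalf τ - 24 * qhalf τ ^ 2 - 32 * qhalf τ ^ 3)
      (by fun_prop) (fun τ => ?_) 4 thetaU_fourth_order hδ
    simp only [hU2, qhalf_vadd_two]
  · refine uniform_of_two_periodic (G := fun τ => thetaW τ - 1 + 8 * qhalf τ - 24 * qhalf τ ^ 2 + 32 * qhalf τ ^ 3)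
      (by fun_prop) (fun τ => ?_) 4 thetaW_fourth_order hδ
    simp only [hW2, qhalf_vadd_two]
  · refine uniform_of_two_periodic (G := fun τ => thetaV τ - 16 * qhalf τ - 64 * qhalf τ ^ 3)
      (by fun_prop) (fun τ => ?_) 5 thetaV_fourth_order hδ
    simp only [hV2, qhalf_vadd_two]

/-- Rewriting `expDecay^k` as `expDecayHalf^{2k}`. [folklore] -/
theorem expDecay_pow_eq (τ : ℍ) (k : ℕ) : expDecay τ ^ k = expDecayHalf τ ^ (2 * k) := by
  rw [expDecay_eq_sq, ← pow_mul]

/-- **Uniform third-order bounds for `E₄, E₆, Δ, E₂` (order `q³ = b⁶`) on `Im τ ≥ δ`.**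
[cite: CohnEtAl2019, §2.1.1 (2.1), (2.3)] -/
theorem eisenstein_uniform {δ : ℝ} (hδ : 0 < δ) :
    (∃ C : ℝ, ∀ τ : ℍ, δ ≤ τ.im → ‖E₄ τ - 1 - 240 * qfun τ - 2160 * qfun τ ^ 2‖ ≤ C * expDecayHalf τ ^ 6) ∧
    (∃ C : ℝ, ∀ τ : ℍ, δ ≤ τ.im → ‖E₆ τ - 1 + 504 * qfun τ + 16632 * qfun τ ^ 2‖ ≤ C * expDecayHalf τ ^ 6) ∧
    (∃ C : ℝ, ∀ τ : ℍ, δ ≤ τ.im → ‖ModularForm.discriminant τ - qfun τ + 24 * qfun τ ^ 2‖ ≤ C * expDecayHalf τ ^ 6) ∧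
    (∃ C : ℝ, ∀ τ : ℍ, δ ≤ τ.im → ‖E2 τ - 1 + 24 * qfun τ + 72 * qfun τ ^ 2‖ ≤ C * expDecayHalf τ ^ 6) := by
  have conv : ∀ {G : ℍ → ℂ}, G =O[atImInfty] (fun τ => expDecay τ ^ 3) → G =O[atImInfty] fun τ => expDecayHalf τ ^ 6 :=
    fun h => h.congr_right fun τ => by rw [expDecay_pow_eq]
  have hE4c : Continuous (⇑E₄ : ℍ → ℂ) := E₄.holo'.continuous
  have hE6c : Continuous (⇑E₆ : ℍ → ℂ) := E₆.holo'.continuous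
  refine ⟨?_, ?_, ?_, ?_⟩
  · refine uniform_of_two_periodic (G := fun τ => E₄ τ - 1 - 240 * qfun τ - 2160 * qfun τ ^ 2)
      (by fun_prop) (fun τ => ?_) 6 (conv E₄_third_order) hδ
    simp only [levelOne_vadd_two, qfun_vadd_two]
  · refine uniform_of_two_periodic (G := fun τ => E₆ τ - 1 + 504 * qfun τ + 16632 * qfun τ ^ 2)
      (by fun_prop) (fun τ => ?_) 6 (conv E₆_third_order) hδ
    simp only [levelOne_vadd_two, qfun_vadd_two]
  · refine uniform_of_two_periodic (G := fun τ => ModularForm.discriminant τ - qfun τ + 24 * qfun τ ^ 2)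
      (by fun_prop) (fun τ => ?_) 6 (conv discriminant_third_order) hδ
    simp only [discriminant_vadd_two, qfun_vadd_two]
  · refine uniform_of_two_periodic (G := fun τ => E2 τ - 1 + 24 * qfun τ + 72 * qfun τ ^ 2)
      (by fun_prop) (fun τ => ?_) 6 (conv E2_third_order) hδ
    simp only [E2_vadd_two, qfun_vadd_two]

/-- **Uniform third-order bounds for `𝓛_S` and `M = 𝓛 − πiτ` on `Im τ ≥ δ`.** [cite: CohnEtAl2019, §2.1.2 (2.10)] -/
theorem logLambda_uniform {δ : ℝ} (hδ : 0 < δ) :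
    (∃ C : ℝ, ∀ τ : ℍ, δ ≤ τ.im → ‖logLambdaS τ + 16 * qhalf τ‖ ≤ C * expDecayHalf τ ^ 3) ∧
    (∃ C : ℝ, ∀ τ : ℍ, δ ≤ τ.im → ‖logLambdaPer τ - (Real.log 16 : ℝ) + 8 * qhalf τ - 12 * qhalf τ ^ 2‖ ≤ C * expDecayHalf τ ^ 3) := by
  refine ⟨?_, ?_⟩
  · refine uniform_of_two_periodic (G := fun τ => logLambdaS τ + 16 * qhalf τ) (by fun_prop) (fun τ => ?_) 3
      logLambdaS_third_order hδ
    simp only [logLambdaS_vadd_two, qhalf_vadd_two]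
  · have hO : (fun τ => logLambdaPer τ - (Real.log 16 : ℝ) + 8 * qhalf τ - 12 * qhalf τ ^ 2) =O[atImInfty]
        fun τ => expDecayHalf τ ^ 3 := logLambda_third_order.congr_left fun τ => by simp only [logLambdaPer]
    refine uniform_of_two_periodic (G := fun τ => logLambdaPer τ - (Real.log 16 : ℝ) + 8 * qhalf τ - 12 * qhalf τ ^ 2)
      (by fun_prop) (fun τ => ?_) 3 hO hδ
    simp only [logLambdaPer_vadd_two, qhalf_vadd_two]

end Literature.NumberTheory.ModularForms
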